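import Summits.QuantumFields.YangMills.Theses.ConvexGribovBody
import Summits.QuantumFields.YangMills.Theorems.ConvexGribovBodyCovarianceBoundDefs
import Summits.QuantumFields.YangMills.Theorems.ConvexGribovBodyCovarianceBoundStubSupMeasurable

/-!
# Stub `stub_floorReduction` of the line `SketchIdeator1` for the crux `BrascampLiebVacuumSC`
# (stmt-QuantumFields-16404, route `ConvexGribovBody`)

The Parseval reduction of the floor of the Coulomb covariance scale: on every torus `(2S+1)⁴`,
for every compact group `G` with a faithful continuous unitary representation `r` and every `β`,

`∫ sup_{h ∈ argmin coul(U,·)} L⁻³ Σ_{j,y} ‖A^h_j(y)‖²_F dμ ≤ Dmax := ⨆_p ∫ supCov r S p U dμ`,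

`μ = wilson4 r β S`, `L = 2S+1`. Ingredients (all elementary):

* character orthogonality on `(ℤ/L)³` for the plane waves of `modeCov`,
  `Σ_p e_p(y) conj(e_p(y')) = L³ δ_{y,y'}` (the one-dimensional sum is
  `AddChar.sum_mulShift` for the primitive character `ZMod.stdAddChar`), whence the matrix-valued
  Parseval identity `Σ_p ‖Σ_y e_p(y) a_y‖²_F = L³ Σ_y ‖a_y‖²_F` and
  `Σ_p cov(U,h,p) = Σ_{j,y} ‖A^h_j(y)‖²_F` pointwise;
* `cov(U,h,p) ≤ supCov r S p U` for every minimiser `h` (`le_ciSup`, bound `modeCov_le`), so the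
  integrand on the left is `≤ L⁻³ Σ_p supCov r S p U` (`ciSup_le`, minimisers exist);
* integrate (`integral_mono_of_nonneg`; `supCov` is bounded and measurable by
  `stub_supMeasurable`, so the right side is integrable — no measurability of the left integrand
  is needed) and bound the mean over the `L³` momenta by the `sup` over momenta.

Helper lemmas live in the sub-namespace `FloorReduction`. No named facts are used.
-/

set_option autoImplicit false

open scoped BigOperators Topology Matrix ComplexConjugate
open Filter MeasureTheory ProbabilityTheory
open Literature.MathematicalPhysics.QuantumFieldTheory
open Summit.QuantumFields.YangMills.Cruxes.CovarianceBound.SupportWindow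

noncomputable section

namespace Summit.QuantumFields.YangMills.Theorems.BrascampLiebVacuumSC

namespace FloorReduction

/-! ### Character orthogonality on `(ℤ/L)³` -/

/-- One plane-wave factor times a conjugate one is a value of the standard additive character:
`e^{-2πi q a/L} · conj(e^{-2πi q b/L}) = stdAddChar (q (b - a))` on `ℤ/L`, `L = 2S+1`. [folklore] -/
theorem phase1_mul_conj (S : ℕ) (q a b : ZMod (2 * S + 1)) :
    Complex.exp (-(2 * Real.pi * Complex.I * (((q.val : ℕ) : ℂ) * ((a.val : ℕ) : ℂ)) /
        (2 * S + 1 : ℂ))) *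
      conj (Complex.exp (-(2 * Real.pi * Complex.I * (((q.val : ℕ) : ℂ) * ((b.val : ℕ) : ℂ)) /
        (2 * S + 1 : ℂ)))) =
    ZMod.stdAddChar (N := 2 * S + 1) (q * (b - a)) := by
  rw [← Complex.exp_conj, ← Complex.exp_add]
  have hk : (q * (b - a) : ZMod (2 * S + 1)) =
      (((q.val : ℤ) * ((b.val : ℤ) - (a.val : ℤ)) : ℤ) : ZMod (2 * S + 1)) := by
    rw [Int.cast_mul, Int.cast_sub, Int.cast_natCast, Int.cast_natCast, Int.cast_natCast,
      ZMod.natCast_zmod_val, ZMod.natCast_zmod_val, ZMod.natCast_zmod_val]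
  rw [hk, ZMod.stdAddChar_coe]
  congr 1
  simp only [map_neg, map_div₀, map_mul, map_add, map_one, map_natCast, map_ofNat,
    Complex.conj_I, Complex.conj_ofReal]
  push_cast
  ring

/-- One-dimensional orthogonality: `Σ_{q ∈ ℤ/L} e^{-2πi q a/L} conj(e^{-2πi q b/L}) = L δ_{ab}`
(`AddChar.sum_mulShift` for the primitive character `ZMod.stdAddChar`). [folklore] -/
theorem sum_phase1_mul_conj (S : ℕ) (a b : ZMod (2 * S + 1)) :
    ∑ q : ZMod (2 * S + 1),
      Complex.exp (-(2 * Real.pi * Complex.I * (((q.val : ℕ) : ℂ) * ((a.val : ℕ) : ℂ)) /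
          (2 * S + 1 : ℂ))) *
        conj (Complex.exp (-(2 * Real.pi * Complex.I * (((q.val : ℕ) : ℂ) * ((b.val : ℕ) : ℂ)) /
          (2 * S + 1 : ℂ)))) =
    if a = b then (2 * S + 1 : ℂ) else 0 := by
  simp_rw [phase1_mul_conj]
  rw [AddChar.sum_mulShift (b - a) (ZMod.isPrimitive_stdAddChar (2 * S + 1)), ZMod.card]
  by_cases hab : a = b
  · subst hab
    simp
  · rw [if_neg hab, if_neg (fun h => hab (sub_eq_zero.1 h).symm), Nat.cast_zero]

/-- **Character orthogonality on `(ℤ/L)³`** for the plane waves of `modeCov`: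
`Σ_p e_p(y) conj(e_p(y')) = L³ δ_{y,y'}`, `e_p(y) = exp(-2πi (Σ_i p_i y_i)/L)`, `L = 2S+1`
(factorise over the three coordinates, `Fintype.prod_sum`, one-dimensional orthogonality).
[folklore] -/
theorem sum_phase_mul_conj (S : ℕ) (y y' : Fin 3 → ZMod (2 * S + 1)) :
    ∑ p : Fin 3 → ZMod (2 * S + 1),
      Complex.exp (-(2 * Real.pi * Complex.I *
          (∑ i : Fin 3, ((p i).val : ℂ) * ((y i).val : ℂ)) / (2 * S + 1 : ℂ))) *
        conj (Complex.exp (-(2 * Real.pi * Complex.I *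
          (∑ i : Fin 3, ((p i).val : ℂ) * ((y' i).val : ℂ)) / (2 * S + 1 : ℂ)))) =
    if y = y' then (((2 * S + 1 : ℝ) ^ 3 : ℝ) : ℂ) else 0 := by
  have hfac : ∀ p z : Fin 3 → ZMod (2 * S + 1),
      Complex.exp (-(2 * Real.pi * Complex.I *
          (∑ i : Fin 3, ((p i).val : ℂ) * ((z i).val : ℂ)) / (2 * S + 1 : ℂ))) =
      ∏ i : Fin 3, Complex.exp (-(2 * Real.pi * Complex.I *
          (((p i).val : ℂ) * ((z i).val : ℂ)) / (2 * S + 1 : ℂ))) := by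
    intro p z
    rw [← Complex.exp_sum]
    congr 1
    simp only [Finset.mul_sum, Finset.sum_div, Finset.sum_neg_distrib]
  have hterm : ∀ p : Fin 3 → ZMod (2 * S + 1),
      Complex.exp (-(2 * Real.pi * Complex.I *
          (∑ i : Fin 3, ((p i).val : ℂ) * ((y i).val : ℂ)) / (2 * S + 1 : ℂ))) *
        conj (Complex.exp (-(2 * Real.pi * Complex.I *
          (∑ i : Fin 3, ((p i).val : ℂ) * ((y' i).val : ℂ)) / (2 * S + 1 : ℂ)))) =
      ∏ i : Fin 3, (Complex.exp (-(2 * Real.pi * Complex.I *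
          (((p i).val : ℂ) * ((y i).val : ℂ)) / (2 * S + 1 : ℂ))) *
        conj (Complex.exp (-(2 * Real.pi * Complex.I *
          (((p i).val : ℂ) * ((y' i).val : ℂ)) / (2 * S + 1 : ℂ))))) := by
    intro p
    rw [hfac p y, hfac p y', map_prod, ← Finset.prod_mul_distrib]
  simp_rw [hterm]
  rw [← Fintype.prod_sum fun i (q : ZMod (2 * S + 1)) =>
    Complex.exp (-(2 * Real.pi * Complex.I * (((q.val : ℕ) : ℂ) * (((y i).val : ℕ) : ℂ)) /
        (2 * S + 1 : ℂ))) *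
      conj (Complex.exp (-(2 * Real.pi * Complex.I * (((q.val : ℕ) : ℂ) * (((y' i).val : ℕ) : ℂ)) /
        (2 * S + 1 : ℂ))))]
  simp_rw [sum_phase1_mul_conj]
  rw [Fintype.prod_ite_zero, Finset.prod_const, Finset.card_univ, Fintype.card_fin]
  by_cases hy : y = y'
  · subst hy
    simp
  · rw [if_neg hy, if_neg (fun h => hy (funext h))]

/-! ### Parseval on a finite group of plane waves -/

/-- **Parseval, scalar form.** If the kernels `e p : ι → ℂ` satisfy the orthogonality relation
`Σ_p e_p(y) conj(e_p(y')) = C δ_{y,y'}`, then `Σ_p |Σ_y e_p(y) f(y)|² = C Σ_y |f(y)|²`.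
[folklore] -/
theorem sum_norm_sq_sum_mul {ι κ : Type*} [Fintype ι] [Fintype κ] [DecidableEq ι]
    (e : κ → ι → ℂ) (C : ℝ)
    (he : ∀ y y' : ι, ∑ p, e p y * conj (e p y') = if y = y' then (C : ℂ) else 0) (f : ι → ℂ) :
    ∑ p, ‖∑ y, e p y * f y‖ ^ 2 = C * ∑ y, ‖f y‖ ^ 2 := by
  have key : ∀ p, ((‖∑ y, e p y * f y‖ ^ 2 : ℝ) : ℂ) =
      ∑ y, ∑ y', (f y * conj (f y')) * (e p y * conj (e p y')) := by
    intro p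
    rw [Complex.ofReal_pow, ← Complex.mul_conj', map_sum, Finset.sum_mul_sum]
    refine Finset.sum_congr rfl fun y _ => Finset.sum_congr rfl fun y' _ => ?_
    rw [map_mul]
    ring
  have hC : ((∑ p, ‖∑ y, e p y * f y‖ ^ 2 : ℝ) : ℂ) = ((C * ∑ y, ‖f y‖ ^ 2 : ℝ) : ℂ) := by
    rw [Complex.ofReal_sum]
    simp_rw [key]
    rw [Finset.sum_comm]
    calc ∑ y, ∑ p, ∑ y', f y * conj (f y') * (e p y * conj (e p y'))
        = ∑ y, ∑ y', f y * conj (f y') * ∑ p, e p y * conj (e p y') := by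
          refine Finset.sum_congr rfl fun y _ => ?_
          rw [Finset.sum_comm]
          refine Finset.sum_congr rfl fun y' _ => ?_
          rw [Finset.mul_sum]
      _ = ∑ y, f y * conj (f y) * C := by
          refine Finset.sum_congr rfl fun y _ => ?_
          simp_rw [he, mul_ite, mul_zero]
          rw [Finset.sum_ite_eq, if_pos (Finset.mem_univ _)]
      _ = ((C * ∑ y, ‖f y‖ ^ 2 : ℝ) : ℂ) := by
          simp_rw [Complex.mul_conj']
          rw [← Finset.sum_mul, mul_comm]
          push_cast
          rfl
  exact_mod_cast hC

/-- **Parseval, matrix form** (squared Frobenius norms): under the same orthogonality relation,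
`Σ_p ‖Σ_y e_p(y) a_y‖²_F = C Σ_y ‖a_y‖²_F` for matrix-valued `a`. [folklore] -/
theorem sum_froSq_sum_smul {ι κ : Type*} [Fintype ι] [Fintype κ] [DecidableEq ι] {N : ℕ}
    (e : κ → ι → ℂ) (C : ℝ)
    (he : ∀ y y' : ι, ∑ p, e p y * conj (e p y') = if y = y' then (C : ℂ) else 0)
    (a : ι → Matrix (Fin N) (Fin N) ℂ) :
    ∑ p, froSq (∑ y, e p y • a y) = C * ∑ y, froSq (a y) := by
  unfold froSq
  simp only [Matrix.sum_apply, Matrix.smul_apply, smul_eq_mul]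
  calc ∑ p, ∑ k, ∑ l, ‖∑ y, e p y * a y k l‖ ^ 2
      = ∑ k, ∑ l, ∑ p, ‖∑ y, e p y * a y k l‖ ^ 2 := by
        rw [Finset.sum_comm]
        exact Finset.sum_congr rfl fun k _ => Finset.sum_comm
    _ = ∑ k, ∑ l, C * ∑ y, ‖a y k l‖ ^ 2 := by
        refine Finset.sum_congr rfl fun k _ => Finset.sum_congr rfl fun l _ => ?_
        exact sum_norm_sq_sum_mul e C he fun y => a y k l
    _ = C * ∑ k, ∑ l, ∑ y, ‖a y k l‖ ^ 2 := by
        simp_rw [Finset.mul_sum]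
    _ = C * ∑ y, ∑ k, ∑ l, ‖a y k l‖ ^ 2 := by
        congr 1
        symm
        rw [Finset.sum_comm]
        exact Finset.sum_congr rfl fun k _ => Finset.sum_comm

/-! ### The covariance integrand summed over momenta -/

variable {G : Type} [Group G] [TopologicalSpace G]

/-- **`Σ_p cov(U,h,p) = Σ_{j,y} ‖A^h_j(y)‖²_F`** (Parseval on `(ℤ/L)³`; the `L⁻³` of `modeCov`
cancels the `L³` of the orthogonality relation). [folklore] -/
theorem sum_modeCov_eq (r : LatticeRep G) (S : ℕ) (U : GaugeConfig 4 (2 * S + 1) G)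
    (h : Site 4 (2 * S + 1) → G) :
    ∑ p : Fin 3 → ZMod (2 * S + 1), modeCov r S U h p =
      ∑ j : Fin 3, ∑ y : Fin 3 → ZMod (2 * S + 1), froSq (gluon r S U h y j) := by
  have hL : (0 : ℝ) < (2 * S + 1 : ℝ) ^ 3 := by positivity
  have hcov : ∀ p : Fin 3 → ZMod (2 * S + 1), modeCov r S U h p =
      (∑ j : Fin 3, froSq (∑ y : Fin 3 → ZMod (2 * S + 1),
        Complex.exp (-(2 * Real.pi * Complex.I *
          (∑ i : Fin 3, ((p i).val : ℂ) * ((y i).val : ℂ)) / (2 * S + 1 : ℂ))) •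
          gluon r S U h y j)) / (2 * S + 1 : ℝ) ^ 3 := fun p => rfl
  simp_rw [hcov]
  rw [← Finset.sum_div, Finset.sum_comm, div_eq_iff hL.ne', Finset.sum_mul]
  refine Finset.sum_congr rfl fun j _ => ?_
  exact (sum_froSq_sum_smul _ _ (sum_phase_mul_conj S) _).trans (mul_comm _ _)

/-- For a minimiser `h`: `L⁻³ Σ_{j,y} ‖A^h_j(y)‖²_F ≤ L⁻³ Σ_p supCov r S p U`. [folklore] -/
theorem floor_integrand_le (r : LatticeRep G) (S : ℕ) (U : GaugeConfig 4 (2 * S + 1) G)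
    (h : Site 4 (2 * S + 1) → G) (hh : IsCoulMin r S U h) :
    (∑ j : Fin 3, ∑ y : Fin 3 → ZMod (2 * S + 1), froSq (gluon r S U h y j)) /
        ((2 * S + 1 : ℝ) ^ 3) ≤
      (∑ p : Fin 3 → ZMod (2 * S + 1), supCov r S p U) / ((2 * S + 1 : ℝ) ^ 3) := by
  refine div_le_div_of_nonneg_right ?_ (by positivity)
  rw [← sum_modeCov_eq]
  refine Finset.sum_le_sum fun p _ => ?_
  exact le_ciSup (f := fun h' : {h // IsCoulMin r S U h} => modeCov r S U h'.1 p)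
    ⟨3 * r.N * (2 * S + 1 : ℝ) ^ 3, by
      rintro _ ⟨h', rfl⟩
      exact SupMeasurable.modeCov_le r S U h'.1 p⟩ ⟨h, hh⟩

/-- Pointwise bound of the floor integrand: `sup_{h ∈ argmin} L⁻³ Σ_{j,y} ‖A^h_j(y)‖²_F ≤
L⁻³ Σ_p supCov r S p U` (minimisers exist, `ciSup_le`). [folklore] -/
theorem iSup_floor_integrand_le [IsTopologicalGroup G] [CompactSpace G] (r : LatticeRep G)
    (S : ℕ) (U : GaugeConfig 4 (2 * S + 1) G) :
    (⨆ h : {h : Site 4 (2 * S + 1) → G // IsCoulMin r S U h},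
        (∑ j : Fin 3, ∑ y : Fin 3 → ZMod (2 * S + 1), froSq (gluon r S U h.1 y j)) /
          ((2 * S + 1 : ℝ) ^ 3)) ≤
      (∑ p : Fin 3 → ZMod (2 * S + 1), supCov r S p U) / ((2 * S + 1 : ℝ) ^ 3) := by
  obtain ⟨h₀, hh₀⟩ := SupMeasurable.exists_isCoulMin r S U
  haveI : Nonempty {h : Site 4 (2 * S + 1) → G // IsCoulMin r S U h} := ⟨⟨h₀, hh₀⟩⟩
  exact ciSup_le fun h => floor_integrand_le r S U h.1 h.2

/-- The floor integrand is nonnegative. [folklore] -/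
theorem iSup_floor_integrand_nonneg (r : LatticeRep G) (S : ℕ)
    (U : GaugeConfig 4 (2 * S + 1) G) :
    0 ≤ (⨆ h : {h : Site 4 (2 * S + 1) → G // IsCoulMin r S U h},
        (∑ j : Fin 3, ∑ y : Fin 3 → ZMod (2 * S + 1), froSq (gluon r S U h.1 y j)) /
          ((2 * S + 1 : ℝ) ^ 3)) :=
  Real.iSup_nonneg fun _ => div_nonneg (Finset.sum_nonneg fun _ _ =>
    Finset.sum_nonneg fun _ _ => SupMeasurable.froSq_nonneg _) (by positivity)

/-- `supCov r S p` is integrable for Wilson's probability measure (bounded and measurable,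
`stub_supMeasurable`). [folklore] -/
theorem integrable_supCov [IsTopologicalGroup G] [CompactSpace G] [MeasurableSpace G]
    [BorelSpace G] (r : LatticeRep G) (β : ℝ) (S : ℕ) (p : Fin 3 → ZMod (2 * S + 1)) :
    Integrable (supCov r S p) (wilson4 r β S) := by
  have hf := stub_supMeasurable G r S p 0
  exact Integrable.of_mem_Icc 0 (3 * r.N * (2 * S + 1 : ℝ) ^ 3) hf.2.2.1.aemeasurable
    (ae_of_all _ fun U => ⟨(hf.2.2.2.2.2 U).1.1, (hf.2.2.2.2.2 U).1.2⟩)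

end FloorReduction

open FloorReduction in
/-- **Stub `stub_floorReduction` (MEASURE THEORY — Parseval floor reduction)** of the line
`SketchIdeator1` for the crux `BrascampLiebVacuumSC`: on every torus `(2S+1)⁴`,
`∫ sup_{h ∈ argmin} L⁻³ Σ_{j,y} ‖A^h_j(y)‖²_F dμ ≤ Dmax = ⨆_p ∫ supCov r S p U dμ`.
Proof: `Σ_p cov(U,h,p) = Σ_{j,y} ‖A^h_j(y)‖²_F` (Parseval on `(ℤ/L)³`) and
`cov(U,h,p) ≤ supCov r S p U` for minimisers `h`, so the integrand is `≤ L⁻³ Σ_p supCov r S p U`;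
integrate (`integral_mono_of_nonneg`, integrability by `stub_supMeasurable`) and bound the mean
over the `L³` momenta by their `sup`. [folklore] -/
theorem stub_floorReduction :
    ∀ (G : Type) [Group G] [TopologicalSpace G] [IsTopologicalGroup G] [CompactSpace G]
    [MeasurableSpace G] [BorelSpace G] (r : LatticeRep G) (β : ℝ) (S : ℕ),
    ∫ U, (⨆ h : {h : Site 4 (2 * S + 1) → G // IsCoulMin r S U h},
        (∑ j : Fin 3, ∑ y : Fin 3 → ZMod (2 * S + 1), froSq (gluon r S U h.1 y j)) /
          ((2 * S + 1 : ℝ) ^ 3)) ∂(wilson4 r β S) ≤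
      ⨆ p : Fin 3 → ZMod (2 * S + 1), ∫ U, supCov r S p U ∂(wilson4 r β S) := by
  intro G _ _ _ _ _ _ r β S
  have hL : (0 : ℝ) < (2 * S + 1 : ℝ) ^ 3 := by positivity
  have hint : Integrable (fun U => (∑ p : Fin 3 → ZMod (2 * S + 1), supCov r S p U) /
      ((2 * S + 1 : ℝ) ^ 3)) (wilson4 r β S) :=
    (integrable_finsetSum _ fun p _ => integrable_supCov r β S p).div_const _
  calc ∫ U, (⨆ h : {h : Site 4 (2 * S + 1) → G // IsCoulMin r S U h},
        (∑ j : Fin 3, ∑ y : Fin 3 → ZMod (2 * S + 1), froSq (gluon r S U h.1 y j)) /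
          ((2 * S + 1 : ℝ) ^ 3)) ∂(wilson4 r β S)
      ≤ ∫ U, (∑ p : Fin 3 → ZMod (2 * S + 1), supCov r S p U) / ((2 * S + 1 : ℝ) ^ 3)
          ∂(wilson4 r β S) :=
        integral_mono_of_nonneg (ae_of_all _ (iSup_floor_integrand_nonneg r S)) hint
          (ae_of_all _ (iSup_floor_integrand_le r S))
    _ = (∑ p : Fin 3 → ZMod (2 * S + 1), ∫ U, supCov r S p U ∂(wilson4 r β S)) /
          ((2 * S + 1 : ℝ) ^ 3) := by
        rw [integral_div, integral_finsetSum _ fun p _ => integrable_supCov r β S p]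
    _ ≤ (∑ _p : Fin 3 → ZMod (2 * S + 1), ⨆ q : Fin 3 → ZMod (2 * S + 1),
          ∫ U, supCov r S q U ∂(wilson4 r β S)) / ((2 * S + 1 : ℝ) ^ 3) :=
        div_le_div_of_nonneg_right (Finset.sum_le_sum fun p _ =>
          le_ciSup (f := fun q : Fin 3 → ZMod (2 * S + 1) =>
            ∫ U, supCov r S q U ∂(wilson4 r β S)) (Set.finite_range _).bddAbove p) hL.le
    _ = ⨆ q : Fin 3 → ZMod (2 * S + 1), ∫ U, supCov r S q U ∂(wilson4 r β S) := by
        rw [Finset.sum_const, Finset.card_univ, nsmul_eq_mul, SupMeasurable.card_slice,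
          mul_div_cancel_left₀ _ hL.ne']

end Summit.QuantumFields.YangMills.Theorems.BrascampLiebVacuumSC

end
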